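import Literature.Computability.Complexity.NSubexp
import Literature.Computability.Complexity.CircuitClasses
import HarnessLib

/-!
# Two class-level ingredients of the Aaronson–van Melkebeek proof of the Kabanets–Impagliazzo theorem

Aaronson and van Melkebeek (*On circuit lower bounds from derandomization*, Theory of Computing 7
(2011) 177–184) re-prove the Kabanets–Impagliazzo theorem "`PIT ∈ NSUBEXP ⟹ NEXP ⊄ P/poly` or
the permanent has no polynomial-size arithmetic circuits" (the tree's named fact
`Literature.Computability.AlgebraicComplexity.kabanets_impagliazzo`, `ValiantBooleanBridge.lean`)
*without* the Impagliazzo–Kabanets–Wigderson theorem `NEXP ⊆ P/poly ⟹ NEXP = MA` and *without*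
Toda's theorem (§1: "Our proof is completely elementary modulo the use of the #P-completeness of
the permanent. The only other nontrivial ingredients are that `NTIME(2^{O(n)})` has a complete
problem under linear-time reductions, and Kannan's circuit lower bounds for `Σ₂ᵖ`"). Their
§3.3 ("The new argument") is the printed chain

  `Σ₂ᵖ ⊆ NTIME(2^{O(n)}) ⊆ SIZE(n^c)` for some constant `c`,                       (3)

contradicting Kannan's theorem (the tree's proved `Literature.Computability.Complexity.kannan_holds`).
In the tree's classes (`NTIME(2^{O(n)})` is `NE = ⋃_c NTIME(2^{c n})` of `Nondeterministic.lean`,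
and `SIZE` bounds every length, so the constant goes inside a union as in `kannan`) the chain is
used by the assembly in the refined form (the tree's rendering, not the printed one)

  `Σ₂ᵖ ⊆ NSUBEXP ⊆ NTIME(2ⁿ) ⊆ NE ⊆ ⋃_c SIZE(c·n^k + c)` for some exponent `k`.

This file vendors, as named facts (D-0014), the two purely Boolean-complexity steps of that
chain that the tree's machine toolkit does not yet prove:

* `NE_subset_SIZE_of_NEXP_subset_PPoly` — the second inclusion of (3) as printed: if
  `NEXP ⊆ P/poly` then there is ONE exponent `k` such that every language of
  `NE = NTIME(2^{O(n)})` has circuits of size `c·n^k + c` for some constant `c` depending on the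
  language (via a complete problem for `NTIME(2^{O(n)})` under linear-time reductions, e.g.
  `{⟨M, x, t⟩ | M accepts x within t steps}`); its sub-case for the tree's `NTIME (fun n => 2 ^ n)`,
  which is all the assembly needs, is the proved corollary
  `NTIME_two_pow_subset_SIZE_of_NEXP_subset_PPoly`;
* `polyExists_NSUBEXP_subset_NSUBEXP` — the closure of `NSUBEXP` under polynomially bounded
  existential projection, used in the proof of their Lemma 3.1 to pass from `coNP ⊆ NSUBEXP` to
  `Σ₂ᵖ ⊆ NSUBEXP` ("(∗) … turns (∗∗) into an NSUBEXP computation on input `x`").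

The first inclusion (their Lemma 3.1, from Valiant's completeness of the permanent and the
Kabanets–Impagliazzo guess-and-verify algorithm) and the assembly are in
`AlgebraicComplexity/ValiantBooleanBridgeAvM.lean`.

## Design notes

* `SIZE s` of the tree (`CircuitClasses.lean`) bounds the circuit size at EVERY length and for
  the given function `s` exactly, whereas Aaronson–van Melkebeek's `SIZE(s(n))` allows finitely
  many exceptional lengths PER LANGUAGE and `SIZE(n^c)` is read up to constant factors. The
  faithful rendering of "`NTIME(2^{O(n)}) ⊆ SIZE(n^c)` for some constant `c`" is therefore ONE
  exponent `k` outside and the language-dependent constant inside: `NE ⊆ ⋃_c SIZE(c·n^k + c)` —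
  exactly the shape `⋃_c SIZE(c·n^k + c)` excluded by the tree's `kannan`
  (`StructuralPH.lean`). (A single constant uniform over all of `NTIME(2ⁿ)` would be false: a
  finite language consisting of one circuit-hard slice is in `NTIME(2ⁿ)` with its own constant.)
* `NE`, `NTIME (fun n => 2 ^ n)` and `NSUBEXP = ⋂_{r>0} NTIME(2^{⌊n^{1/r}⌋})` are the tree's
  verifier-form classes over Mathlib's `TM2` machines (`Nondeterministic.lean`, `NSubexp.lean`);
  `NTIME(2ⁿ) ⊆ NE` is the member `c = 1` of the union, so no monotonicity of `NTIME` is used.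
* Discharging the first fact needs a universal (verifier) machine for Mathlib's `FinTM2` with
  polynomial overhead — not in the tree. The second fact IS discharged:
  `polyExists_NSUBEXP_subset_NSUBEXP_holds` (`PolyExistsNTIME.lean`, with `PolyExistsNTIMEArith`,
  `…Programs`, `…Clock`, `…Shuffle`) builds the verifier from a witness-splitting stage behind the
  tree's truncating wrapper (`TruncMapMachine.lean`) and the computation of `2^{⌊m^{1/r'}⌋}` in
  unary by compiled stack programs.

## References

* S. Aaronson, D. van Melkebeek, *On circuit lower bounds from derandomization*, Theory of
  Computing 7 (2011) 177–184, §2 (notation `SIZE`, `NSUBEXP`), §3.1 (Lemma 3.1 and its proof),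
  §3.3 (display (3)).
* R. Kannan, *Circuit-size lower bounds and non-reducibility to sparse sets*, Inform. Control 55
  (1982) 40–56, Thm. 2.
* S. Arora, B. Barak, *Computational Complexity: A Modern Approach*, CUP 2009, Def. 2.1, §2.6.2
  (`NEXP`), Def. 6.5 (`P/poly`), Thm. 2.6 (guess-and-verify).
-/

namespace Literature.Computability.Complexity

/-- **`NEXP ⊆ P/poly` forces ONE polynomial exponent on the circuit size of all of
`NE = NTIME(2^{O(n)})`.** Aaronson–van Melkebeek 2011, §3.3, second inclusion of display (3):
`NTIME(2^{O(n)}) ⊆ SIZE(n^c)` "for some constant `c`", which "follows from our second hypothesis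
(`NEXP ⊆ SIZE(poly(n))`) and the fact that `NTIME(2^{O(n)})` has a complete problem under
linear-time reductions, e.g., `{⟨M, x, t⟩ | M is a nondeterministic Turing machine that accepts
x in at most t steps}`"; their `SIZE(s(n))` (§2) allows finitely many exceptional lengths per
language and is read up to constant factors, hence the rendering with one exponent `k` and a
language-dependent constant inside the union: `NE ⊆ ⋃_c SIZE(c·n^k + c)` (`NE = ⋃_c NTIME(2^{cn})`,
`Nondeterministic.lean`). Mechanism: the complete language `K` lies in `NEXP ⊆ P/poly`, so
`K ∈ SIZE(p)` for one polynomial `p` of degree `k`; a language `L ∈ NTIME(2^{c n})` maps to `K` by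
`x ↦ ⟨M_L, x, t_L(|x|)⟩`, a word of linear length `a_L·|x| + d_L` all of whose non-`x` bits depend
on `|x|` only, so hard-wiring them into the circuits of `K` gives circuits for `L` of size
`≤ p(a_L n + d_L) ≤ c_L · n^k + c_L` at every length. Named fact: a discharge is a universal
verifier machine for Mathlib's `FinTM2` with polynomial slow-down, which the tree does not have.
[cite: AaronsonMelkebeek2011, §3.3 (display (3), second inclusion)] -/
def NE_subset_SIZE_of_NEXP_subset_PPoly : Prop :=
  NEXP ⊆ PPoly → ∃ k : ℕ, NE ⊆ ⋃ c : ℕ, SIZE (fun n => c * n ^ k + c)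

/-- **The sub-case `NTIME(2ⁿ)`** of `NE_subset_SIZE_of_NEXP_subset_PPoly` (proved corollary; the
shape consumed by the assembly of pnp.S39 via `NSUBEXP ⊆ NTIME(2ⁿ)`): `NTIME (fun n => 2 ^ n)` is
the member `c = 1` of `NE = ⋃_c NTIME(2^{c n})`. [cite: AaronsonMelkebeek2011, §3.3 (display (3), second inclusion)] -/
theorem NTIME_two_pow_subset_SIZE_of_NEXP_subset_PPoly (h : NE_subset_SIZE_of_NEXP_subset_PPoly)
    (hP : NEXP ⊆ PPoly) : ∃ k : ℕ, NTIME (fun n => 2 ^ n) ⊆ ⋃ c : ℕ, SIZE (fun n => c * n ^ k + c) := by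
  obtain ⟨k, hk⟩ := h hP
  refine ⟨k, fun L hL => hk ?_⟩
  exact Set.subset_iUnion (fun c : ℕ => NTIME fun n => 2 ^ (c * n)) 1 (by simpa using hL)

/-- **`NSUBEXP` is closed under polynomially bounded existential projection**:
`polyExists NSUBEXP ⊆ NSUBEXP`, i.e. if `L' ∈ ⋂_{ε>0} NTIME(2^{n^ε})` and
`x ∈ L ↔ ∃ y, |y| ≤ p(|x|) ∧ ⟨x, y⟩ ∈ L'`, then `L ∈ ⋂_{ε>0} NTIME(2^{n^ε})` (guess `y` together
with the certificate `z` of `⟨x, y⟩ ∈ L'`; the pair `⟨x, y⟩` has length `≤ q(|x|)` for a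
polynomial `q` of degree `d`, and `2^{⌊q(n)^{1/(2dr)}⌋} ≤ 2^K · 2^{⌊n^{1/r}⌋}` for a constant `K`,
so for the member `r` of the intersection one runs the member `r' = 2dr` of the verifiers of
`L'`). This is the step of Aaronson–van Melkebeek 2011, proof of Lemma 3.1: "Assuming that
`coNP ⊆ NSUBEXP`, we can replace the predicate (∗) in (1) by an NSUBEXP computation on the
combined input `x, y`, which turns (∗∗) [`x ∈ L ⟺ ∃ y : (∗)`] into an NSUBEXP computation on
input `x`." In the tree's verifier-form `NTIME` (`Nondeterministic.lean`) the new verifier must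
moreover cut over-long certificates, which needs `2^{⌊m^{1/r'}⌋}` in unary. Named fact (D-0014),
DISCHARGED: `polyExists_NSUBEXP_subset_NSUBEXP_holds` (`PolyExistsNTIME.lean`).
[cite: AaronsonMelkebeek2011, §3.1 (proof of Lemma 3.1)] -/
def polyExists_NSUBEXP_subset_NSUBEXP : Prop :=
  polyExists NSUBEXP ⊆ NSUBEXP

end Literature.Computability.Complexity
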